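import Summits.QuantumFields.YangMills.Theorems.UnitScaleTiltHalvingCombPairGauge
import Literature.MathematicalPhysics.QuantumFieldTheory.Balaban1983to89.B7Eq47AveragedBondVsStraight
import Literature.MathematicalPhysics.QuantumFieldTheory.Balaban1983to89.B7Prop6Flat
import Literature.MathematicalPhysics.QuantumFieldTheory.Balaban1983to89.B8Eq115GaugeFixing
import Literature.MathematicalPhysics.QuantumFieldTheory.Balaban1983to89.B8Thm2LogB
import HarnessLib

/-!
# Line H (`BirthV10.stub_halvingStep`, stmt-QuantumFields-19200) — (B-al-4)₃'s **ω-ROW (F-ω): THE MULTISCALE OSCILLATION OF THE DATUM GAUGE `u₁`** — the level-`j`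
# corner samples of a gauge `u` with `u•W = U′` inside one `(j+1)`-block oscillate EXACTLY by the comb holonomy of `W̄ʲ`, hence by
# `d(L−1)·(256(d+1)(d+4)·α₀·L^{2(j−k)} + Lʲ·w)` ([Balaban1985Averaging] (11)∕(45) p.24, (42)–(43), (47) p.25, Prop. 2 (52)–(54) p.26; [Balaban1985RegularSpaces] (1.15) p.78)

Cell `ym3-torus` (HUMAN RULING D-0037: YM₃ on T³ is ladder rung R3 — NOT d = 4, NOT infinite volume, NOT a mass gap, NOT the Clay problem), width seat `ym3-torus-px9`
gen 6 ((F-ω) pen offer 04:34Z on ym-ust-20520-w3 g9's LOCATE `LOCATE-BAL4-3-ROWS-w3g9.md` §2, LEAD-H ★w5-19200 g7 WORD 21 «the consumer names the letters»).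
`--supports stmt-QuantumFields-19200 --as helper`; THEOREMS ONLY (0 `def`, 0 `sorry`, standard axioms); count-neutral; nothing here claims (B-al-4)₃, the (b)-row,
(M2′), the stub, the crux or the gap.

WHY.  (B-al-4)₃ (ym-ust-20520-w3 g9, row `hG` of the B-al-3 door ⧗p696030 `…HalvingHStokesRowOfCombDefect.hStokes_of_rows`) runs ✓p694594
`HalvingEffGaugeTowerRatio.norm_effGauge_ratio_le_of_pyramid` with the reference family `A_j := (R̄ʲu₁ ∘ Lab_j)⁻¹` and displays the row `hosc`: the oscillation `e_j` of `A_j` between a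
block centre and its stair ends.  Its located residue (F-ω) (LOCATE §2): «for `u₁` with `u₁•W = U′` (the (R1) link `mgauge 1 u₁ W = U′`), `U′` block-axial (`InAx` at `1`) and
`ε₀`-regular (`InAk`), `W` in its chart (`‖W_b − 1‖ ≤ L^{−k}c′`): `u₁(Lʲ⁺¹c)⁻¹·u₁(Lʲx) = W̄ʲ(Γ_{Lc,x})` for `x ∈ B(Lc)` and its SIZE is geometric and k-uniform».  THIS FILE is
that row at the `ℤᵈ` level, for any complete normed algebra, by three tree facts: (i) lit ✓`B7Prop6Flat.avgIter_gaugeAct_units` ((11) for the `k`-fold average, NO hypothesis) +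
lit ✓`B8Eq115GaugeFixing.axialFn_gaugeAct` + block-axiality ⇒ the IDENTITY; (ii) ✓`HalvingCombPairGauge.norm_axialFn_sub_one_le_of_bondBound` ⇒ comb size `≤ |x − Lc|₁·δ_j`;
(iii) lit ✓`B7Eq47AveragedBondVsStraight.norm_avgIter_sub_straight_le` (the k-level «averaged bond vs straight line», k-UNIFORM under Prop. 2) + the straight segment of `Lʲ`
chart-small bonds ⇒ `δ_j ≤ 256(d+1)(d+4)·α₀·(Lʲ∕Lᵏ)² + Lʲ·w` — NO new induction.  The member instantiation (socket letters: `U′ = pull X̂ 0`, `α₀ = 2ε₀` by ✓`pdev_pull_lt`,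
block-axiality from the `InAx`-guard, `w = L^{−k}c′` from the chart row) is a sibling file, cut to the consumer's `Lab_j`∕pyramid letters when posted.

WHAT (namespace `…Theorems.HalvingOmegaRow`; `Site d = ℤᵈ`, any `d`, `L ≥ 2`, values in the units of a complete normed `ℂ`-algebra `𝔸` with `‖1‖ = 1`):
* §1 `norm_hol_seg_sub_one_le` (a straight segment of `n` bonds each within `w` of `1` is within `n·w` of `1`),
  ★ `inv_mul_sample_eq_axialFn_avgIter` — THE IDENTITY: `u•W = U′` and `Ū′ʲ(Γ_{Lc, Lc+r}) = 1` ⇒ `u(Lʲ⁺¹c)⁻¹·u(Lʲ(Lc + r)) = W̄ʲ(Γ_{Lc, Lc+r})`.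
* §2 `fine_bond_in_block` (the fine bonds of the straight segment under a level-`j` bond of the block `B(Lc)` lie in the fine `(j+1)`-block of `c`),
  ★ `norm_avgIter_sub_one_le_in_block` — `δ_j`: every level-`j` bond of `W̄ʲ` in `B(Lc)` is within `256(d+1)(d+4)α₀(Lʲ∕Lᵏ)² + Lʲ·w` of `1`;
  ★★ `norm_inv_mul_sample_sub_one_le` — (F-ω): `‖u(Lʲ⁺¹c)⁻¹·u(Lʲ(Lc + r)) − 1‖ ≤ d(L−1)·(256(d+1)(d+4)α₀(Lʲ∕Lᵏ)² + Lʲ·w)`, `r ∈ [0, L)ᵈ`, `j ≤ k`.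
HONEST SCOPE.  A `ℤᵈ` letter over landed lit theorems; the member corollary and the base change to the consumer's centred labels are NOT here.

References: T. Bałaban, CMP **98** (1985) 17–51 [Balaban1985Averaging] ((8) p.18, (9) p.18, (11) p.19, (42)–(43) pp.23–24, (45) p.24, (47) p.25, Prop. 2 (52)–(54) p.26);
CMP **99** (1985) 75–102 [Balaban1985RegularSpaces] ((1.15) p.78, (1.19) p.79, (1.29)–(1.30) p.81).
-/

set_option autoImplicit false

noncomputable section

open scoped BigOperators

namespace Summit.QuantumFields.YangMills.Theorems.HalvingOmegaRow

open Literature.MathematicalPhysics.QuantumFieldTheory.Balaban1983to89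
open B7Prop1Explicit (Site e boxVec axialFn gaugeAct hol seg l1 U1 mem_U1 hol_mem hol_seg_natCast_succ)
open B7Prop2Explicit (avgIter pdev C0 c2' AvgClosed avgIter_mem)
open B7AvgGaugeCovariance (uLev uLev_apply pdev_gaugeAct)
open B7Prop6Flat (avgIter_gaugeAct_units)
open B7Eq47AveragedBondVsStraight (norm_avgIter_sub_straight_le)
open B8Eq115GaugeFixing (axialFn_gaugeAct)
open B8Lemma1NonAbelian (boxVec_nonneg)
open HalvingCombPairGauge (norm_axialFn_sub_one_le_of_bondBound)

variable {d : ℕ} {𝔸 : Type*} [NormedRing 𝔸] [NormOneClass 𝔸] [NormedAlgebra ℂ 𝔸] [CompleteSpace 𝔸]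

/-! ## §1 Telescoping, straight segments, and the identity -/

omit [NormedAlgebra ℂ 𝔸] [CompleteSpace 𝔸] in
/-- **A straight segment of `n` bonds, each within `w` of `1`, transports within `n·w` of `1`** ((9): `V(Γ₁ ∪ Γ₂) = V(Γ₁)V(Γ₂)`, every factor in the unit ball;
LOCAL hypothesis: only the `n` bonds of the segment are read). [cite: Balaban1985Averaging, (9) p.18, p.25] -/
theorem norm_hol_seg_sub_one_le (W : Site d → Fin d → 𝔸ˣ) (hWU : ∀ x κ, W x κ ∈ U1 𝔸) (x : Site d) (μ : Fin d) {w : ℝ} :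
    ∀ n : ℕ, (∀ i : ℕ, i < n → ‖((W (x + (i : ℤ) • e μ) μ : 𝔸ˣ) : 𝔸) - 1‖ ≤ w) →
      ‖((hol W x (seg μ (n : ℤ)) : 𝔸ˣ) : 𝔸) - 1‖ ≤ n * w
  | 0, _ => by simp
  | n + 1, h => by
    have ih := norm_hol_seg_sub_one_le W hWU x μ n fun i hi => h i (Nat.lt_succ_of_lt hi)
    have hlast := h n (Nat.lt_succ_self n)
    rw [show ((n + 1 : ℕ) : ℤ) = (n : ℤ) + 1 by push_cast; rfl, hol_seg_natCast_succ, Units.val_mul]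
    have hY : ‖((W (x + (n : ℤ) • e μ) μ : 𝔸ˣ) : 𝔸)‖ ≤ 1 := (mem_U1.1 (hWU _ _)).1
    calc _ ≤ ‖((hol W x (seg μ (n : ℤ)) : 𝔸ˣ) : 𝔸) - 1‖ + ‖((W (x + (n : ℤ) • e μ) μ : 𝔸ˣ) : 𝔸) - 1‖ := by
          -- `XY − 1 = (X − 1)Y + (Y − 1)`, `‖Y‖ ≤ 1` (lit ✓`Prop7FlatCurrentLinearisation.norm_mul_sub_one_le`, inlined to keep the imports light)
          rw [show ∀ X Y : 𝔸, X * Y - 1 = (X - 1) * Y + (Y - 1) from fun X Y => by noncomm_ring]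
          exact (norm_add_le _ _).trans (add_le_add ((norm_mul_le _ _).trans (mul_le_of_le_one_right (norm_nonneg _) hY)) le_rfl)
      _ ≤ n * w + w := add_le_add ih hlast
      _ = (n + 1 : ℕ) * w := by push_cast; ring

omit [NormOneClass 𝔸] in
/-- ★ **THE IDENTITY (F-ω)**: if `u•W = U′` ((8)) and the `j`-fold average `Ū′ʲ` is block-axial at the block `B(Lc)` ((1.15): `Ū′ʲ(Γ_{Lc, Lc+r}) = 1`), then the level-`j` corner
samples of `u` oscillate by the comb holonomy of `W̄ʲ`: `u(Lʲ⁺¹c)⁻¹ · u(Lʲ(Lc + r)) = W̄ʲ(Γ_{Lc, Lc+r})` — by (11) for the `k`-fold average `\overline{(u•W)}ʲ = u_j • W̄ʲ`,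
`u_j(z) = u(Lʲz)` (lit, no hypothesis) and (8) along the tree contour. [cite: Balaban1985Averaging, (8) p.18, (11) p.19, p.24, (43) p.24; Balaban1985RegularSpaces, (1.15) p.78] -/
theorem inv_mul_sample_eq_axialFn_avgIter (L : ℕ) (U' W : Site d → Fin d → 𝔸ˣ) (u : Site d → 𝔸ˣ) (hR1 : gaugeAct u W = U')
    (j : ℕ) (c : Site d) (r : Fin d → Fin L)
    (hax : axialFn (avgIter L U' j) ((L : ℤ) • c) ((L : ℤ) • c + boxVec L r) = 1) :
    (u (((L : ℤ) ^ (j + 1)) • c))⁻¹ * u (((L : ℤ) ^ j) • ((L : ℤ) • c + boxVec L r)) =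
      axialFn (avgIter L W j) ((L : ℤ) • c) ((L : ℤ) • c + boxVec L r) := by
  rw [← hR1, avgIter_gaugeAct_units L u W j, axialFn_gaugeAct] at hax
  simp only [uLev_apply] at hax
  have e1 : ((L : ℤ) ^ j) • ((L : ℤ) • c) = ((L : ℤ) ^ (j + 1)) • c := by rw [smul_smul, pow_succ]
  rw [e1] at hax
  set g := u (((L : ℤ) ^ (j + 1)) • c)
  set h := u (((L : ℤ) ^ j) • ((L : ℤ) • c + boxVec L r))
  set X := axialFn (avgIter L W j) ((L : ℤ) • c) ((L : ℤ) • c + boxVec L r)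
  calc g⁻¹ * h = g⁻¹ * (g * X * h⁻¹) * h := by rw [hax, mul_one]
    _ = X := by group

/-! ## §2 The size: `δ_j` from «averaged bond vs straight line» + the chart, then (F-ω) -/

/-- **THE FINE BONDS UNDER A LEVEL-`j` BOND OF THE BLOCK `B(Lc)` LIE IN THE FINE `(j+1)`-BLOCK OF `c`**: for `Lc ≤ x`, `x + e_μ ≤ Lc + (L−1)` and `i < Lʲ`, the fine bond
`(Lʲx + ie_μ, μ)` has both ends in `[Lʲ⁺¹c, Lʲ⁺¹c + Lʲ⁺¹ − 1]`. [folklore] -/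
theorem fine_bond_in_block {L : ℕ} (hL : 1 ≤ L) (j : ℕ) (c x : Site d) (μ : Fin d)
    (hx : (L : ℤ) • c ≤ x) (hxμ : x + e μ ≤ (L : ℤ) • c + fun _ => (L : ℤ) - 1) (i : ℕ) (hi : i < L ^ j) :
    ((L : ℤ) ^ (j + 1)) • c ≤ ((L : ℤ) ^ j) • x + (i : ℤ) • e μ ∧
      ((L : ℤ) ^ j) • x + (i : ℤ) • e μ + e μ ≤ ((L : ℤ) ^ (j + 1)) • c + fun _ => (L : ℤ) ^ (j + 1) - 1 := by
  have hLj : (1 : ℤ) ≤ (L : ℤ) ^ j := by exact_mod_cast Nat.one_le_pow _ _ hL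
  have hi' : (i : ℤ) + 1 ≤ (L : ℤ) ^ j := by exact_mod_cast hi
  constructor
  · intro ν
    have h1 := hx ν
    simp only [Pi.smul_apply, smul_eq_mul, Pi.add_apply, B7Prop1Explicit.e_apply] at h1 ⊢
    have h0 : (0 : ℤ) ≤ (i : ℤ) * (if ν = μ then 1 else 0) := by split_ifs <;> simp
    have h2 : (L : ℤ) ^ (j + 1) * c ν = (L : ℤ) ^ j * ((L : ℤ) * c ν) := by ring
    rw [h2]
    nlinarith
  · intro ν
    have h1 := hxμ ν
    have h0 := hx ν
    simp only [Pi.smul_apply, smul_eq_mul, Pi.add_apply, B7Prop1Explicit.e_apply] at h1 h0 ⊢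
    have h2 : (L : ℤ) ^ (j + 1) * c ν = (L : ℤ) ^ j * ((L : ℤ) * c ν) := by ring
    have h3 : (L : ℤ) ^ (j + 1) = (L : ℤ) ^ j * L := by ring
    rw [h2, h3]
    by_cases hν : ν = μ
    · subst hν
      simp only [if_true, mul_one] at h1 ⊢
      -- `x_μ ≤ Lc_μ + L − 2`
      nlinarith
    · simp only [if_neg hν, mul_zero, add_zero] at h1 ⊢
      nlinarith

/-- ★ **`δ_j` — EVERY LEVEL-`j` BOND OF `W̄ʲ` IN THE BLOCK `B(Lc)` IS WITHIN `256(d+1)(d+4)·α₀·(Lʲ∕Lᵏ)² + Lʲ·w` OF `1`**, for a `G`-valued `W` (`G` closed under the average,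
`G ≤ U1`) with `pdev W < α₀L^{−2k}` under Prop. 2's windows, whose fine bonds in the fine `(j+1)`-block of `c` are within `w` of `1`: «averaged bond vs straight line» (lit, k-uniform) +
the straight segment of `Lʲ` chart-small fine bonds. [cite: Balaban1985Averaging, (42)-(43) pp.23-24, (47) p.25, Prop. 2 (52)-(54) p.26, (9) p.18] -/
theorem norm_avgIter_sub_one_le_in_block (L : ℕ) (hL : 2 ≤ L) {G : Subgroup 𝔸ˣ} (hG : AvgClosed d L G) (k : ℕ)
    (W : Site d → Fin d → 𝔸ˣ) (hW : ∀ x κ, W x κ ∈ G) {α₀ : ℝ} (hα : 0 < α₀) (hα3 : C0 d * α₀ ≤ 1 / 3) (hα2 : 2 * α₀ ≤ c2' d L)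
    (h52 : pdev W < α₀ * (((L : ℝ) ^ k)⁻¹) ^ 2) {j : ℕ} (hjk : j ≤ k) (c : Site d) {w : ℝ}
    (hw : ∀ (y : Site d) (μ : Fin d), ((L : ℤ) ^ (j + 1)) • c ≤ y → y + e μ ≤ ((L : ℤ) ^ (j + 1)) • c + (fun _ => (L : ℤ) ^ (j + 1) - 1) →
      ‖((W y μ : 𝔸ˣ) : 𝔸) - 1‖ ≤ w)
    (x : Site d) (μ : Fin d) (hx : (L : ℤ) • c ≤ x) (hxμ : x + e μ ≤ (L : ℤ) • c + fun _ => (L : ℤ) - 1) :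
    ‖((avgIter L W j x μ : 𝔸ˣ) : 𝔸) - 1‖ ≤ 256 * (d + 1) * (d + 4) * α₀ * ((L : ℝ) ^ j * ((L : ℝ) ^ k)⁻¹) ^ 2 + (L : ℝ) ^ j * w := by
  have hL1 : 1 ≤ L := le_trans (by norm_num) hL
  have hWU : ∀ x κ, W x κ ∈ U1 𝔸 := fun x κ => hG.le_U1 (hW x κ)
  have hstr := norm_avgIter_sub_straight_le L hL hG k W hW hα hα3 hα2 h52 j hjk x μ
  have hseg : ‖((hol W (((L : ℤ) ^ j) • x) (seg μ ((L ^ j : ℕ) : ℤ)) : 𝔸ˣ) : 𝔸) - 1‖ ≤ (L ^ j : ℕ) * w :=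
    norm_hol_seg_sub_one_le W hWU _ μ (L ^ j) fun i hi => by
      obtain ⟨h1, h2⟩ := fine_bond_in_block hL1 j c x μ hx hxμ i hi
      exact hw _ μ h1 h2
  have hcast : ((L ^ j : ℕ) : ℝ) = (L : ℝ) ^ j := by push_cast; rfl
  rw [hcast] at hseg
  calc _ ≤ ‖((avgIter L W j x μ : 𝔸ˣ) : 𝔸) - ((hol W (((L : ℤ) ^ j) • x) (seg μ ((L ^ j : ℕ) : ℤ)) : 𝔸ˣ) : 𝔸)‖ +
        ‖((hol W (((L : ℤ) ^ j) • x) (seg μ ((L ^ j : ℕ) : ℤ)) : 𝔸ˣ) : 𝔸) - 1‖ := norm_sub_le_norm_sub_add_norm_sub _ _ _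
    _ ≤ _ := add_le_add hstr hseg

/-- ★★ **THE ω-ROW (F-ω) AT THE `ℤᵈ` LEVEL.**  `u•W = U′` ((8); the (R1) link `mgauge 1 u W = U′`), `u ∈ U1`, `W` `G`-valued with `pdev U′ < α₀L^{−2k}` under Prop. 2's windows
(so `pdev W = pdev U′` by (45)), `Ū′ʲ` block-axial at `B(Lc)` ((1.15)), and the fine bonds of `W` in the fine `(j+1)`-block of `c` within `w` of `1` (the chart).  Then for every
`r ∈ [0, L)ᵈ`: **`‖u(Lʲ⁺¹c)⁻¹·u(Lʲ(Lc + r)) − 1‖ ≤ d(L−1)·(256(d+1)(d+4)·α₀·(Lʲ∕Lᵏ)² + Lʲ·w)`** — geometric in `j`, k-uniform; no tower row, no `s`.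
[cite: Balaban1985Averaging, (8) p.18, (11) p.19, (45) p.24, (47) p.25, Prop. 2 (54) p.26; Balaban1985RegularSpaces, (1.15) p.78, (1.29)-(1.30) p.81] -/
theorem norm_inv_mul_sample_sub_one_le (L : ℕ) (hL : 2 ≤ L) {G : Subgroup 𝔸ˣ} (hG : AvgClosed d L G) (k : ℕ)
    (U' W : Site d → Fin d → 𝔸ˣ) (hW : ∀ x κ, W x κ ∈ G) (u : Site d → 𝔸ˣ) (hu : ∀ x, u x ∈ U1 𝔸) (hR1 : gaugeAct u W = U')
    {α₀ : ℝ} (hα : 0 < α₀) (hα3 : C0 d * α₀ ≤ 1 / 3) (hα2 : 2 * α₀ ≤ c2' d L)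
    (h52 : pdev U' < α₀ * (((L : ℝ) ^ k)⁻¹) ^ 2) {j : ℕ} (hjk : j ≤ k) (c : Site d)
    (hax : ∀ r : Fin d → Fin L, axialFn (avgIter L U' j) ((L : ℤ) • c) ((L : ℤ) • c + boxVec L r) = 1)
    {w : ℝ} (hw0 : 0 ≤ w)
    (hw : ∀ (y : Site d) (μ : Fin d), ((L : ℤ) ^ (j + 1)) • c ≤ y → y + e μ ≤ ((L : ℤ) ^ (j + 1)) • c + (fun _ => (L : ℤ) ^ (j + 1) - 1) →
      ‖((W y μ : 𝔸ˣ) : 𝔸) - 1‖ ≤ w)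
    (r : Fin d → Fin L) :
    ‖(((u (((L : ℤ) ^ (j + 1)) • c))⁻¹ * u (((L : ℤ) ^ j) • ((L : ℤ) • c + boxVec L r)) : 𝔸ˣ) : 𝔸) - 1‖ ≤
      (d * ((L : ℝ) - 1)) * (256 * (d + 1) * (d + 4) * α₀ * ((L : ℝ) ^ j * ((L : ℝ) ^ k)⁻¹) ^ 2 + (L : ℝ) ^ j * w) := by
  have hL1 : 1 ≤ L := le_trans (by norm_num) hL
  have h52W : pdev W < α₀ * (((L : ℝ) ^ k)⁻¹) ^ 2 := by rw [← pdev_gaugeAct hu W, hR1]; exact h52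
  have hWjU : ∀ x κ, avgIter L W j x κ ∈ U1 𝔸 := fun x κ => hG.le_U1 (avgIter_mem L hL hG k W hW hα hα3 hα2 h52W j hjk x κ)
  rw [inv_mul_sample_eq_axialFn_avgIter L U' W u hR1 j c r (hax r)]
  set δ : ℝ := 256 * (d + 1) * (d + 4) * α₀ * ((L : ℝ) ^ j * ((L : ℝ) ^ k)⁻¹) ^ 2 + (L : ℝ) ^ j * w with hδ
  -- the comb inside the block `[Lc, Lc + (L−1)]`
  have hB : ∀ (x : Site d) (μ : Fin d), (L : ℤ) • c ≤ x → x + e μ ≤ ((L : ℤ) • c + fun _ => (L : ℤ) - 1) →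
      ‖((avgIter L W j x μ : 𝔸ˣ) : 𝔸) - 1‖ ≤ δ := fun x μ hx hxμ =>
    norm_avgIter_sub_one_le_in_block L hL hG k W hW hα hα3 hα2 h52W hjk c hw x μ hx hxμ
  have hL2 : (2 : ℤ) ≤ L := by exact_mod_cast hL
  have hL0 : (0 : ℤ) ≤ (L : ℤ) - 1 := by linarith
  have hlo : (L : ℤ) • c ≤ (L : ℤ) • c + boxVec L r := le_add_of_nonneg_right (boxVec_nonneg L r)
  have hhi : (L : ℤ) • c + boxVec L r ≤ (L : ℤ) • c + fun _ => (L : ℤ) - 1 := by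
    intro ν
    simp only [Pi.add_apply, boxVec]
    have := (r ν).isLt
    have : ((r ν : ℕ) : ℤ) ≤ (L : ℤ) - 1 := by omega
    linarith
  have hself : (L : ℤ) • c ≤ (L : ℤ) • c + fun _ => (L : ℤ) - 1 := fun ν => by simp only [Pi.add_apply]; linarith
  have hcomb := norm_axialFn_sub_one_le_of_bondBound (avgIter L W j) hWjU hB (y := (L : ℤ) • c) (x := (L : ℤ) • c + boxVec L r)
    le_rfl hself hlo hhi
  rw [add_sub_cancel_left] at hcomb
  have hδ0 : 0 ≤ δ := by rw [hδ]; positivity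
  have hl1 : (l1 (boxVec L r) : ℝ) ≤ d * ((L : ℝ) - 1) := B8Thm2LogB.l1_boxVec_le hL1 r
  exact hcomb.trans (mul_le_mul_of_nonneg_right hl1 hδ0)

end Summit.QuantumFields.YangMills.Theorems.HalvingOmegaRow

end
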